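import Mathlib
import Summits.NavierStokesRegularity.NavierStokesRegularity.Theorems.WakeRatchetTailRatchetDSS
import HarnessLib

/-!
# `WakeRatchet.TailRatchet` (stmt-NavierStokesRegularity-21808) — negative lemma modulo the
# existence of persistent DSS fronts: ANY family of admissible non-trivial discretely self-similar
# blow-up waves on a fixed comparable table at arbitrarily small scale ratios refutes the crux

By `WakeRatchetDSS.no_dssWave_of_tailRatchet` (companion support file), `TailRatchet` implies that
below a threshold `ε₁(R) > 0` NO E₂(R) table carries a non-trivial admissible DSS wave
(`IsDSSWave`, any period, any delay) — the survival window and the wake fraction `1 − dssMu` play no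
role.  Hence the KILL CRITERIA below (the hypothesis `hF` is the construction the tree cannot yet
supply: exact travelling-front solutions of the renormalised lattice of some E₂(R) table, e.g. the
self-similar invasion front of the constant-flux branch `u_n = c Λ^{-n/3}` of the dyadic member
`dyadicTable ∈ E₂(2)` — the Katz–Pavlović / Cheskidov chain `u̇_n = Λ^{n-1}u_{n-1}² − Λ^n u_n u_{n+1}`
at base `Λ = (1+ε₀)^{5/2}`, which numerically blows up from one-shell data through such a front for
every `ε₀ > 0`, with per-shell energy ratio `μ = Λ^{-2z}`, `z ≈ 0.28–0.34`, i.e. `1 − μ = O(ε₀)`).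
Compare the tree's `not_noSurvivingDSS_of_persistent_waves`, which needs (S_a)-SURVIVING waves.

HONEST FRAMING: MODEL lattice ODEs only (Tao 2016 §4); nothing here concerns the Navier–Stokes
equations; these theorems settle nothing by themselves (conditional refutations).
-/

noncomputable section

set_option linter.dupNamespace false

namespace Summit.NavierStokesRegularity.NavierStokesRegularity.Theorems

namespace WakeRatchetTailRatchetNegative

open Literature.Analysis.FluidPDE Literature.Analysis.FluidPDE.TaoCascade
open WakeRatchetDSS WakeRatchetTail

/-! ## Kill criteria: any persistent family of DSS fronts refutes the crux -/

/-- **Kill criterion for `TailRatchet`.**  Admissible non-trivial DSS waves (of ANY residue — the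
survival window plays no role) on E₂(R) tables, `R ≥ 1`, at arbitrarily small scale ratios refute
`TailRatchet`.  (Negative lemma modulo the existence of such fronts; compare the tree's
`not_noSurvivingDSS_of_persistent_waves`, which needs SURVIVING ones.)
[cite: Tao2016AveragedNS, §4; cell vocabulary] -/
theorem tailRatchet_false_of_persistentDSSWaves {R : ℝ} (hR : 1 ≤ R)
    (hF : ∀ ε : ℝ, 0 < ε → ∃ ε₀ : ℝ, 0 < ε₀ ∧ ε₀ ≤ ε ∧
      ∃ α : Fin 4 → Fin 4 → Fin 4 → ℤ × ℤ × ℤ → ℝ, InTableClass R α ∧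
        ∃ (q : ℕ) (π : Equiv.Perm (Fin q)) (T : ℝ) (Φ : Fin q → ℝ → Em 4),
          IsDSSWave ε₀ α π T Φ ∧ ∃ r x, Φ r x ≠ 0) :
    ¬ Summit.NavierStokesRegularity.NavierStokesRegularity.Theses.WakeRatchet.TailRatchet := by
  intro h
  obtain ⟨ε₁, hε₁, H⟩ := no_dssWave_of_tailRatchet h R hR
  obtain ⟨ε₀, hε₀, hle, α, hα, q, π, T, Φ, hW, r, x, hne⟩ := hF ε₁ hε₁
  exact hne (H ε₀ hε₀ hle α hα q π T Φ hW r x)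

/-- **Kill criterion, dyadic form.**  Admissible non-trivial DSS blow-up fronts of the DYADIC member
`dyadicTable ∈ E₂(2)` (the Katz–Pavlović / Cheskidov chain at base `Λ = (1+ε₀)^{5/2}`) at
arbitrarily small scale ratios refute `TailRatchet` — e.g. the self-similar invasion front of the
constant-flux (Kolmogorov) branch, whose per-shell energy ratio `μ = Λ^{-2z}` tends to `1`.
[cite: Tao2016AveragedNS, §1.2 (dyadic model), §4; cell vocabulary] -/
theorem tailRatchet_false_of_dyadicDSSWaves
    (hF : ∀ ε : ℝ, 0 < ε → ∃ ε₀ : ℝ, 0 < ε₀ ∧ ε₀ ≤ ε ∧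
      ∃ (q : ℕ) (π : Equiv.Perm (Fin q)) (T : ℝ) (Φ : Fin q → ℝ → Em 4),
        IsDSSWave ε₀ dyadicTable π T Φ ∧ ∃ r x, Φ r x ≠ 0) :
    ¬ Summit.NavierStokesRegularity.NavierStokesRegularity.Theses.WakeRatchet.TailRatchet := by
  refine tailRatchet_false_of_persistentDSSWaves (R := 2) (by norm_num) fun ε hε => ?_
  obtain ⟨ε₀, hε₀, hle, q, π, T, Φ, hW, hne⟩ := hF ε hε
  exact ⟨ε₀, hε₀, hle, dyadicTable, inTableClass_dyadicTable le_rfl, q, π, T, Φ, hW, hne⟩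


/-! ## The same objection binds the registered stub `stub_inviscid` of the line `birth` -/

/-- **`stub_inviscid` ⟹ no admissible DSS wave below threshold.**  The registered inviscid stub of
the skeleton `Cruxes/TailRatchet/Lines/birth.lean` (its statement quoted verbatim as the hypothesis:
the tail contraction for every uniformly bounded admissible INVISCID eternal solution of every E₂(R)
table) already implies that below a threshold no E₂(R) table carries a non-trivial admissible DSS
wave of any period — every such wave IS a uniformly bounded admissible inviscid eternal solution
(`IsDSSWave.isEternal_dssEmbed`, `uniformBound_dssEmbed`).
[cite: Tao2016AveragedNS, §4 Thm. 4.2 (statement shape), §6.4; cell vocabulary] -/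
theorem no_dssWave_of_stubInviscid
    (h : ∀ R : ℝ, 1 ≤ R → ∃ w : ℝ, 0 < w ∧ ∃ εs : ℝ, 0 < εs ∧ ∀ ε₀ : ℝ, 0 < ε₀ → ε₀ ≤ εs →
      ∀ α : Fin 4 → Fin 4 → Fin 4 → ℤ × ℤ × ℤ → ℝ, InTableClass R α →
        ∀ W : ℤ → ℝ → Em 4, IsEternal ε₀ α W → UniformBound W →
          ∀ (n : ℤ) (M : ℝ), (∀ σ : ℝ, ∑' k : ℕ, physEnergy ε₀ W (n + k) σ ≤ M) →
            ∀ σ : ℝ, ∑' k : ℕ, physEnergy ε₀ W (n + 1 + k) σ ≤ (1 - w) * M) :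
    ∀ R : ℝ, 1 ≤ R → ∃ ε₁ : ℝ, 0 < ε₁ ∧ ∀ ε₀ : ℝ, 0 < ε₀ → ε₀ ≤ ε₁ →
      ∀ α : Fin 4 → Fin 4 → Fin 4 → ℤ × ℤ × ℤ → ℝ, InTableClass R α →
        ∀ (q : ℕ) (π : Equiv.Perm (Fin q)) (T : ℝ) (Φ : Fin q → ℝ → Em 4),
          IsDSSWave ε₀ α π T Φ → ∀ (r : Fin q) (x : ℝ), Φ r x = 0 := by
  intro R hR
  obtain ⟨w, hw, εs, hεs, H⟩ := h R hR
  set w' : ℝ := min w (1 / 2) with hw'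
  have hw'1 : w' ≤ 1 := (min_le_right _ _).trans (by norm_num)
  refine ⟨min εs (w' / 5), lt_min hεs (by positivity), fun ε₀ hε₀ hle α hα q π T Φ hW r x => ?_⟩
  have hthr : (1 + ε₀) ^ 5 * (1 - w') ≤ 1 :=
    pow_five_mul_sub_le_one hw'1 hε₀.le (hle.trans (min_le_right _ _))
  have hp : 0 < orderOf π := orderOf_pos π
  have hT : 0 < (orderOf π : ℝ) * T := mul_pos (by exact_mod_cast hp) hW.delay_pos
  -- contraction at the weakened rate `w'` for the carried eternal solution
  have hC : ∀ (n : ℤ) (M : ℝ), (∀ σ : ℝ, ∑' k : ℕ, physEnergy ε₀ (dssEmbed π T Φ r) (n + k) σ ≤ M) →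
      ∀ σ : ℝ, ∑' k : ℕ, physEnergy ε₀ (dssEmbed π T Φ r) (n + 1 + k) σ ≤ (1 - w') * M := by
    intro n M hM σ
    have hM0 : 0 ≤ M :=
      (tsum_nonneg fun k : ℕ => physEnergy_nonneg ε₀ (dssEmbed π T Φ r) (n + (k : ℤ)) σ).trans (hM σ)
    have h1 := H ε₀ hε₀ (hle.trans (min_le_left _ _)) α hα (dssEmbed π T Φ r)
      (hW.isEternal_dssEmbed r) (uniformBound_dssEmbed hW r) n M hM σ
    exact h1.trans (mul_le_mul_of_nonneg_right (by linarith [min_le_left w (1 / 2)]) hM0)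
  have h0 := trivial_of_contraction hε₀ hα.2.1 (hW.isEternal_dssEmbed r) (uniformBound_dssEmbed hW r)
    hT hw'1 hthr (dssEmbed_shift π T Φ r) hC 0 x
  simpa [dssEmbed] using h0

/-- **Kill criterion for `stub_inviscid`.**  Admissible non-trivial DSS waves on E₂(R) tables at
arbitrarily small scale ratios refute the registered inviscid stub (statement quoted verbatim) — the
line `birth` dies with the crux on any such family. [cite: Tao2016AveragedNS, §4; cell vocabulary] -/
theorem stubInviscid_false_of_persistentDSSWaves {R : ℝ} (hR : 1 ≤ R)
    (hF : ∀ ε : ℝ, 0 < ε → ∃ ε₀ : ℝ, 0 < ε₀ ∧ ε₀ ≤ ε ∧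
      ∃ α : Fin 4 → Fin 4 → Fin 4 → ℤ × ℤ × ℤ → ℝ, InTableClass R α ∧
        ∃ (q : ℕ) (π : Equiv.Perm (Fin q)) (T : ℝ) (Φ : Fin q → ℝ → Em 4),
          IsDSSWave ε₀ α π T Φ ∧ ∃ r x, Φ r x ≠ 0) :
    ¬ (∀ R : ℝ, 1 ≤ R → ∃ w : ℝ, 0 < w ∧ ∃ εs : ℝ, 0 < εs ∧ ∀ ε₀ : ℝ, 0 < ε₀ → ε₀ ≤ εs →
      ∀ α : Fin 4 → Fin 4 → Fin 4 → ℤ × ℤ × ℤ → ℝ, InTableClass R α →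
        ∀ W : ℤ → ℝ → Em 4, IsEternal ε₀ α W → UniformBound W →
          ∀ (n : ℤ) (M : ℝ), (∀ σ : ℝ, ∑' k : ℕ, physEnergy ε₀ W (n + k) σ ≤ M) →
            ∀ σ : ℝ, ∑' k : ℕ, physEnergy ε₀ W (n + 1 + k) σ ≤ (1 - w) * M) := by
  intro h
  obtain ⟨ε₁, hε₁, H⟩ := no_dssWave_of_stubInviscid h R hR
  obtain ⟨ε₀, hε₀, hle, α, hα, q, π, T, Φ, hW, r, x, hne⟩ := hF ε₁ hε₁
  exact hne (H ε₀ hε₀ hle α hα q π T Φ hW r x)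

end WakeRatchetTailRatchetNegative

end Summit.NavierStokesRegularity.NavierStokesRegularity.Theorems

end
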